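import Summits.QuantumFields.YangMills.Theorems.BalabanUVNodesK1V6Defs

/-!
# K1⁷ `StabilityBAtRecordR13SepCoPH` (stmt-QuantumFields-20542) — PREMISE U1 PER LETTER, kernel companion (IDEA-2 g15)

Answer material for CRIT-1 g5's ask «K1⁷ lead ∕ idea-2 lane (premise U1 per letter)» (HOME STATUS 2026-08-28T07:42:36Z):
for each print letter of `Node00.Stage13HParams F 2`, (a) is «one class, the letter moved» a STRUCTURE UPDATE (a dial) or a
CONSTRUCTOR SECTION (the letter indexes the type of another field), and (b) is the β of record — hence the (0.20)-histories
`gOfRecord₁₃`, node O's v6 run rows (`K1V6Defs.RunRowsAtSomeRecord13PWS`: `RunConstRemainder ∕ b ≤ B ∕ B + r ≤ w.βup ∕ PS floor −M`,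
all on `Node00.betaOfRecord₁₃ F 2 θ.toStage13Params`) and K0's box ceiling — BLIND to the letter (`rfl`) or does it READ it.

Everything here is `def` + `rfl`; nothing of Bałaban is asserted or discharged.  K1⁷ is OPEN.  [Balaban1987RG1] Thm 2 ∕ (0.31) p.259 is
unproved in print.  R4 closes only the CONDITIONAL finite-𝕋⁴ rung `BalabanLadder.UV` — not continuum, not OS, not the Yang–Mills mass gap, not Clay.
Companion memo: `Cruxes/StabilityBAtRecordR13SepCoPH/U1-PER-LETTER-idea2-g15.md`.
-/

open Literature.MathematicalPhysics.QuantumFieldTheory.Balaban1983to89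
open Literature.MathematicalPhysics.QuantumFieldTheory.Balaban1983to89.T4Continuum

namespace Summit.QuantumFields.YangMills.Cruxes.StabilityBAtRecordR13SepCoPH.Idea2g15

variable {F : T4Family}

/-! ## §1 DIALS — letters a structure update moves inside one class (idea-4 g11 `setEps29` model; CRIT-1 g5 F6 «class-frozen») -/

/-- ε₁ = `ε₂₉` ([I] (2.9) p.266; Thm 3 p.264 «ε₁ depends on M»). -/
def setEps29 (θ : Node00.Stage13HParams F 2) (e : ℝ) : Node00.Stage13HParams F 2 := { θ with ε₂₉ := e }

/-- `γ` ([I] Thm 3 p.264 «γ depends on all other constants»). -/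
def setGamma (θ : Node00.Stage13HParams F 2) (g : ℝ) : Node00.Stage13HParams F 2 := { θ with γ := g }

/-- `κ`, the (2.28) radii constants `C₀, C₁` (print's α₀, α₁) and `E₀`, all inside `s2.lf` ([III] (2.23), (2.28) p.258–259; [I] Thm 3 «κ ≥ κ₀», «α₀, α₁ depend on M»). -/
def setLF (θ : Node00.Stage13HParams F 2) (κ C₀ C₁ E₀ : ℝ) : Node00.Stage13HParams F 2 :=
  { θ with s2 := { θ.s2 with lf := { θ.s2.lf with κ := κ, C₀ := C₀, C₁ := C₁, E₀ := E₀ } } }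

/-- `εbg` (Record 8), `cβ`, `A₁` (Record 9). -/
def setEbgCβA₁ (θ : Node00.Stage13HParams F 2) (e c a : ℝ) : Node00.Stage13HParams F 2 := { θ with εbg := e, cβ := c, A₁ := a }

/-- [IV] letters `Nsz`, `Nmem` inside `τ9`, `M` untouched: a dial (`ζ`, `ppSel` are typed over `τ9.M` only, and `{θ.τ9 with …}.M ≡ θ.τ9.M`). -/
def setNszNmem (θ : Node00.Stage13HParams F 2) (a b : ℕ) : Node00.Stage13HParams F 2 := { θ with τ9 := { θ.τ9 with Nsz := a, Nmem := b } }

/-- `ν`-dials: `M₁`, `p₀`, `A₀`, `logσ₀`, `εreg`, `ε₀` each move by structure update (kernel: these five∕six elaborate; `ν.M₂` and `ν.r` do NOT — §2). -/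
def setM₁ (θ : Node00.Stage13HParams F 2) (a : ℕ) : Node00.Stage13HParams F 2 := { θ with ν := { θ.ν with M₁ := a } }
def setP₀ (θ : Node00.Stage13HParams F 2) (a : ℕ) : Node00.Stage13HParams F 2 := { θ with ν := { θ.ν with p₀ := a } }
def setA₀ (θ : Node00.Stage13HParams F 2) (a : ℝ) : Node00.Stage13HParams F 2 := { θ with ν := { θ.ν with A₀ := a } }
def setLogσ₀ (θ : Node00.Stage13HParams F 2) (a : ℝ) : Node00.Stage13HParams F 2 := { θ with ν := { θ.ν with logσ₀ := a } }
def setEreg (θ : Node00.Stage13HParams F 2) (a : ℝ) : Node00.Stage13HParams F 2 := { θ with ν := { θ.ν with εreg := a } }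
def setE₀ (θ : Node00.Stage13HParams F 2) (a : ℝ) : Node00.Stage13HParams F 2 := { θ with ν := { θ.ν with ε₀ := a } }

/-! ## §2 CONSTRUCTOR SECTIONS — letters that index the TYPE of another field: `M = τ9.M` (`ζ : ZetaOfRecord F N ν τ9.M`, `ppSel : PpSelOfRecord F ν τ9.M`),
`ν.M₂` (`ζ`), `ν.r` (`ppSel`).  `{θ with τ9 := {θ.τ9 with M := M'}}` alone does NOT elaborate («Type mismatch θ.ppSel … PpSelOfRecord F θ.ν θ.τ9.M …»,
scratch `Idea2g15U1SettersNeg.lean`); the move must RE-SUPPLY the indexed fields (of record: `zeta316OfRecord … M …`, the pp-selection at `M`). -/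

/-- THE `M`-MOVE with the two re-supplied `M`-indexed objects. -/
def setM (θ : Node00.Stage13HParams F 2) (M' : ℕ) (ζ' : Node00.ZetaOfRecord F 2 θ.ν M') (pp' : Node00.PpSelOfRecord F θ.ν M') :
    Node00.Stage13HParams F 2 :=
  { θ with τ9 := { θ.τ9 with M := M' }, ζ := ζ', ppSel := pp' }

theorem setM_M (θ : Node00.Stage13HParams F 2) (M' : ℕ) (ζ' : Node00.ZetaOfRecord F 2 θ.ν M') (pp' : Node00.PpSelOfRecord F θ.ν M') :
    (setM θ M' ζ' pp').τ9.M = M' := rfl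

/-- THE `ν`-MOVE (whole numerics record) with re-supplied `ζ`, `ppSel`. -/
def setNu (θ : Node00.Stage13HParams F 2) (ν' : Node00.Stage7Numerics) (ζ' : Node00.ZetaOfRecord F 2 ν' θ.τ9.M) (pp' : Node00.PpSelOfRecord F ν' θ.τ9.M) :
    Node00.Stage13HParams F 2 :=
  { θ with ν := ν', ζ := ζ', ppSel := pp' }

/-! ## §3 β-BLINDNESS OF RECORD, BY `rfl` — `betaOfRecord₁₃ θ = betaOfRecord₈Tχ F N TβOfRecord₁₃ (chiFixed29 F N θ.ν θ.ε₂₉) θ.toStage8Params`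
(Record13.lean :180–186, :169–172): it reads EXACTLY `ν.εreg` (through `critCfgOfRecord`, SmallFieldChi29OfRecord.lean :77 ∕ :117 ∕ :151), `ε₂₉`, `εbg`,
the colour carrier `(Vβ, ιβ, ρ8, bV)`, the reference history `v₀` (`beta0OfMerged`, BetaOfRecord.lean :192) and `γ` (THE BOX of `betaOfMerged`, :198) — and
NOTHING of `τ9 = (M, Nsz, Nmem)`, `s2` (κ, κ₀, E₀, B₀, C₀, q₀, C₁, q₁, A₀, p₀, cB, βc, B, C, Mr, cR), `cβ`, `A₁`, `ζ`, `ppSel`, `Rz ∕ Zt ∕ Zr ∕ Zh ∕ Phih`,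
nor of `ν.{M₁, M₂, r, p₀, A₀, logσ₀, ε₀}`.  So along the moves of print's letters κ, M, ε₀, α₀, α₁ (five of [I] Thm 3's six) node O's v6 run rows and
K0's box ceiling are LITERALLY THE SAME ROWS; only ε₁ = ε₂₉ (and γ, as the box) are seen. -/

theorem betaOfRecord₁₃_setLF (θ : Node00.Stage13HParams F 2) (κ C₀ C₁ E₀ : ℝ) :
    Node00.betaOfRecord₁₃ F 2 (setLF θ κ C₀ C₁ E₀).toStage13Params = Node00.betaOfRecord₁₃ F 2 θ.toStage13Params := rfl

theorem gOfRecord₁₃_setLF (θ : Node00.Stage13HParams F 2) (κ C₀ C₁ E₀ : ℝ) (p : B12.RunParams) :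
    Node00.gOfRecord₁₃ F 2 (setLF θ κ C₀ C₁ E₀).toStage13Params p = Node00.gOfRecord₁₃ F 2 θ.toStage13Params p := rfl

theorem betaOfRecord₁₃_setNszNmem (θ : Node00.Stage13HParams F 2) (a b : ℕ) :
    Node00.betaOfRecord₁₃ F 2 (setNszNmem θ a b).toStage13Params = Node00.betaOfRecord₁₃ F 2 θ.toStage13Params := rfl

theorem betaOfRecord₁₃_setCβA₁ (θ : Node00.Stage13HParams F 2) (c a : ℝ) :
    Node00.betaOfRecord₁₃ F 2 (setEbgCβA₁ θ θ.εbg c a).toStage13Params = Node00.betaOfRecord₁₃ F 2 θ.toStage13Params := rfl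

/-- **β OF RECORD IS `M`-BLIND**: whatever `ζ'`, `pp'` are re-supplied at the new `M`. -/
theorem betaOfRecord₁₃_setM (θ : Node00.Stage13HParams F 2) (M' : ℕ) (ζ' : Node00.ZetaOfRecord F 2 θ.ν M') (pp' : Node00.PpSelOfRecord F θ.ν M') :
    Node00.betaOfRecord₁₃ F 2 (setM θ M' ζ' pp').toStage13Params = Node00.betaOfRecord₁₃ F 2 θ.toStage13Params := rfl

theorem gOfRecord₁₃_setM (θ : Node00.Stage13HParams F 2) (M' : ℕ) (ζ' : Node00.ZetaOfRecord F 2 θ.ν M') (pp' : Node00.PpSelOfRecord F θ.ν M')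
    (p : B12.RunParams) : Node00.gOfRecord₁₃ F 2 (setM θ M' ζ' pp').toStage13Params p = Node00.gOfRecord₁₃ F 2 θ.toStage13Params p := rfl

/-- **β of record is `ε₀`-blind** (print's small-field radius enters `domAltOfRecord ν = {V | PlaqSmall ν.ε₀ V}`, i.e. `dom ∕ Repr ∕ IndAss` of the core — not β). -/
theorem betaOfRecord₁₃_setE₀ (θ : Node00.Stage13HParams F 2) (a : ℝ) :
    Node00.betaOfRecord₁₃ F 2 (setE₀ θ a).toStage13Params = Node00.betaOfRecord₁₃ F 2 θ.toStage13Params := rfl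

/-- **β of record reads `ν` only through `ν.εreg`**: every other component moved (with `ζ`, `ppSel` re-supplied), `εreg` kept ⇒ `rfl`. -/
theorem betaOfRecord₁₃_setNu_of_εreg (θ : Node00.Stage13HParams F 2) (M₁ M₂ r p₀ : ℕ) (A₀ logσ₀ ε₀ : ℝ)
    (ζ' : Node00.ZetaOfRecord F 2 ⟨M₁, M₂, r, p₀, A₀, logσ₀, θ.ν.εreg, ε₀⟩ θ.τ9.M) (pp' : Node00.PpSelOfRecord F ⟨M₁, M₂, r, p₀, A₀, logσ₀, θ.ν.εreg, ε₀⟩ θ.τ9.M) :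
    Node00.betaOfRecord₁₃ F 2 (setNu θ ⟨M₁, M₂, r, p₀, A₀, logσ₀, θ.ν.εreg, ε₀⟩ ζ' pp').toStage13Params = Node00.betaOfRecord₁₃ F 2 θ.toStage13Params := rfl

end Summit.QuantumFields.YangMills.Cruxes.StabilityBAtRecordR13SepCoPH.Idea2g15
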